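import Summits.BirchSwinnertonDyer.BirchSwinnertonDyer.Theorems.GenusKolyvaginAtTwoMinimalTwinBSDTwoEggAllImages
import Summits.BirchSwinnertonDyer.BirchSwinnertonDyer.Theorems.GenusKolyvaginAtTwoMinimalTwinBSDTwoAnalyticLossless
import Summits.BirchSwinnertonDyer.BirchSwinnertonDyer.Theorems.GenusKolyvaginAtTwoMinimalTwinBSDTwoSwappedPairSilentDescent
import HarnessLib

/-!
# Route `GenusKolyvaginAtTwo`, crux U₂ `MinimalTwinBSDTwo` (stmt-BirchSwinnertonDyer-22985), LINE 23 «twin_swap»: THE IMAGE-FREE EXPONENT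
# EXP⁺_all IS LOSSLESS AT EVERY TAMAGAWA DEPTH — on the egg, U₂ ⟺ EXP⁺_all modulo wall + rank-zero 2-converse + PRINT

Seat `bsd-line-gk2-p3` g31 (PROVER seat 3/3, cell `bsd-f1-sign2`), `--supports stmt-BirchSwinnertonDyer-22985` (helper; closes nothing).  Sequel of
`…MinimalTwinBSDTwoEggAllImages` (p777498: the image-free silent-prime twin package and egg engine).  THEOREMS ONLY (no definition, no named fact, no
`sorry`); standard axioms.  **BSD is NOT proved by this file; U₂, the wall, the 2-converse and EXP± are NOT proved; no item is closed.**  Every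
theorem is CONDITIONAL on its displayed hypotheses.

WHY.  `…EggAllImages` §4 derives U₂ on the whole egg locus (`Δ_W > 0`, `W(ℚ)` meets the egg, ANY image of `ρ̄_{W,2}`, ANY `C(W)`) from S1 + CONV₀ +
PRINT + the image-free exponent hypothesis EXP⁺_all («at every silent prime Heegner field `ℚ(√−ℓ)` with `L(W^{(−ℓ)},1) ≠ 0` and every conductor-1
datum, `2^{ord₂ c + ord₂ C(W)} ∥ P(1)`»).  A refuter must know that this STRONGER-looking hypothesis (more curves than gk2-p2's p776404 text, which
asked `ρ̄_{W,2}` onto) is still exactly the BSD₂ content: this file proves the converse at every depth and for every image — gk2-p3 g29's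
`AnalyticLossless.exponent_of_bsdp_of_silentPrime_of_lValue_ne_zero` (depth `0`, `ρ̄_{W,2}` onto) with both restrictions removed, via this lineage's
depth-free `Silent.twoDivExponent_eq_of_bsdp_silent` (g28) and the image-free egg dichotomy of `…EggAllImages` §2.

* §7 **`exponent_of_bsdp_of_silentPrime_allDepth_allImages`** — `W` non-CM, `r_an = 1`, `#Sel₂ = 2`, `Δ_W > 0`, `MeetsEgg W`, `BSD₂(W)`; `K = ℚ(√−ℓ)`
  silent Heegner with `L(W^{(d_K)},1) ≠ 0`; any conductor-`1` datum ⟹ `2^{ord₂ c + ord₂ C(W)} ∥ P(1)` (mod GZ, GZK, modularity, Milne, S1).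
* §8 **`expPos_allImages_of_bsdp_egg_of_facts`** — (U₂ on the egg) ⟹ EXP⁺_all (image-free text of `…EggAllImages` §4), mod the same; and
  **`bsdp_egg_iff_expPos_allImages_of_facts`** — modulo PRINT + S1 + CONV₀ + the modular parametrisation: **U₂ on the egg ⟺ EXP⁺_all** (image-free,
  every depth).  So the image-free egg hypothesis is LOSSLESS: refuting it refutes U₂ itself (given the wall, the converse and print).

References: [GrossZagier1986] I (6.3), V §2 (2.2); [Kramer1981] §2 Props. 3, 6; [MazurRubin2010] Cor. 3.4 (i); [Milne1972ArithmeticAV] §1 Thm. 1;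
[McCallumLMS1991] §5 Lemma 5.1; [EdixhovenManin1991] §1; [Miller2011LMS] Def. 1.1.
-/

set_option autoImplicit false
set_option linter.dupNamespace false -- `Summit.<P>.<Sub>` repeats `BirchSwinnertonDyer` (D-0017)

noncomputable section

open scoped Classical

open WeierstrassCurve NumberField Literature.NumberTheory.EllipticCurves
  Literature.NumberTheory.EllipticCurves.ModularForms
  Literature.NumberTheory.EllipticCurves.Rank1Residual
  Literature.NumberTheory.QuadraticFields
  Summit.BirchSwinnertonDyer.Rank1Residual
  Summit.BirchSwinnertonDyer.Rank1Residual.AdditivePotMult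
  Summit.BirchSwinnertonDyer.Rank1Residual.F1Sign2
  Summit.BirchSwinnertonDyer.BirchSwinnertonDyer.Rank1Residual
  Summit.BirchSwinnertonDyer.BirchSwinnertonDyer.Theorems
  Summit.BirchSwinnertonDyer.BirchSwinnertonDyer.Theorems.GenusExact.TwinSwap
  Summit.BirchSwinnertonDyer.BirchSwinnertonDyer.Theorems.GenusExact.TwinSwap.Silent

open Summit.BirchSwinnertonDyer.BirchSwinnertonDyer.Theorems.GenusExact.TwinSwap.Ledger.Line25
  (entireLFunction_twist_one_ne_zero_of_rankZeroTwoConverse_of_natCard_selmerGroup_eq_one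
    not_isOfFinAddOrder_derivedPoint_one_of_rankOne_of_lValue_ne_zero)
open Summit.BirchSwinnertonDyer.BirchSwinnertonDyer.Theorems.GenusExact.TwinSwap.Silent
  (twoDivExponent_eq_of_bsdp_silent padicValNat_two_tamagawaProduct_twin_eq_of_discr_eq_neg_prime_of_noRoot)

namespace Summit.BirchSwinnertonDyer.BirchSwinnertonDyer.Theorems.GenusExact.TwinSwap.EggAllImages

/-! ## §7 EXP⁺ from BSD₂ at every depth and for every image -/

/-- **THE IMAGE-FREE, DEPTH-FREE EXPONENT FROM BSD₂ ON THE EGG.**  `W/ℚ` globally minimal, non-CM, `r_an(W) = 1`, `#Sel₂(W) = 2`, `Δ_W > 0`,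
`W(ℚ)` meets the egg (any image of `ρ̄_{W,2}`, any `C(W)`), and `BSD₂(W)`; `K = ℚ(√−ℓ)` (`ℓ` prime, the `2`-division cubic rootless mod `ℓ`, `d_K` odd
`≠ −3`, Heegner for `N_W`) with `L(W^{(d_K)},1) ≠ 0`; `(Dt, β, ι, d₁)` any conductor-`1` datum.  Then **`2^{ord₂ c + ord₂ C(W)} ∥ P(1)`**.  Proof: `P(1)`
has infinite order (GZ pair + modularity, p773223 §1) hence an exact `2`-divisibility exponent `M₀`; the globally minimal twin `Wd ≅ W^{(d_K)}` is SILENT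
(`ord₂ C(Wd) = ord₂ C(W)`, g28), `2`-Selmer-trivial (the image-free egg dichotomy, `…EggAllImages` §2), non-CM, of analytic rank `0` (by `L ≠ 0`), so
`BSD₂(Wd)` by the wall S1; then g28's depth-free `Silent.twoDivExponent_eq_of_bsdp_silent` pins `M₀ = ord₂ c + ord₂ C(W)`.  CONDITIONAL on GZ (at
level `N_W`), GZK, modularity, Milne, S1; proves nothing about BSD; closes nothing.
[cite: GrossZagier1986, I (6.3), V §2 (2.2)] [cite: Kramer1981, §2 Props. 3, 6] [cite: Milne1972ArithmeticAV, §1 Thm. 1] [cite: EdixhovenManin1991, §1] -/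
theorem exponent_of_bsdp_of_silentPrime_allDepth_allImages
    (hGZ : ∀ (N : ℕ) [NeZero N] (W : WeierstrassCurve ℚ) (K : Type) [Field K] [NumberField K], gross_zagier N W K)
    (hGZK : rank_eq_analyticRank_of_analyticRank_le_one) (hmod : hasEntireLFunction_rat)
    (hMilneC : Milne1972.bsdQuotient_baseChange_quadratic_anyModel)
    (hS1 : ∀ (W : WeierstrassCurve ℚ) [W.IsElliptic] [W.IsGloballyMinimal],
      ¬ W.HasCM → W.analyticRank = 0 → Nat.card (W.selmerGroup 2) = 1 → BSDp W 2)
    (W : WeierstrassCurve ℚ) [W.IsElliptic] [W.IsGloballyMinimal] [NeZero (W.conductorNorm ℤ)]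
    (hcm : ¬ W.HasCM) (hr : W.analyticRank = 1) (hSel : Nat.card (W.selmerGroup 2) = 2) (hΔ : 0 < W.Δ) (hegg : MeetsEgg W)
    (hBW : BSDp W 2)
    {K : Type} [Field K] [NumberField K] (hK : IsImaginaryQuadratic K) {ℓ : ℕ} (hℓ : ℓ.Prime) (hd : NumberField.discr K = -(ℓ : ℤ))
    (hnoRoot : ∀ x : ZMod ℓ, 4 * x ^ 3 + ((integralModelInt W).b₂ : ZMod ℓ) * x ^ 2 +
      2 * ((integralModelInt W).b₄ : ZMod ℓ) * x + ((integralModelInt W).b₆ : ZMod ℓ) ≠ 0)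
    (hodd : Odd (NumberField.discr K)) (h3 : NumberField.discr K ≠ -3) (hH : SatisfiesHeegnerHypothesis (W.conductorNorm ℤ) K)
    (hL : (W.quadraticTwist (NumberField.discr K : ℚ)).entireLFunction 1 ≠ 0)
    (Dt : ModularParametrizationData W (W.conductorNorm ℤ)) (β : ℤ) (ι : K →+* ℂ) (d₁ : KolyvaginHeegnerData Dt β ι 1) :
    (∃ Q : (W.baseChange (ringClassField K ι 1)).toAffine.Point,
        ((2 ^ (padicValInt 2 Dt.c + padicValNat 2 W.tamagawaProduct) : ℕ) : ℤ) • Q = d₁.derivedPoint) ∧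
      (¬ ∃ Q : (W.baseChange (ringClassField K ι 1)).toAffine.Point,
        ((2 ^ (padicValInt 2 Dt.c + padicValNat 2 W.tamagawaProduct + 1) : ℕ) : ℤ) • Q = d₁.derivedPoint) := by
  have hD0 : (NumberField.discr K : ℚ) ≠ 0 := by exact_mod_cast NumberField.discr_ne_zero K
  haveI hEt : (W.quadraticTwist (NumberField.discr K : ℚ)).IsElliptic := W.isElliptic_quadraticTwist hD0
  have hc0 : Dt.c ≠ 0 := Dt.maninConstant_ne_zero_holds
  -- `P(1)` of infinite order and its exact exponent `M₀`
  have hy : ¬ IsOfFinAddOrder d₁.derivedPoint :=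
    not_isOfFinAddOrder_derivedPoint_one_of_rankOne_of_lValue_ne_zero hmod W K (hGZ _ W K) hK hH hr hL d₁
  obtain ⟨M₀, hdiv, hndiv⟩ := GenusKoly.exists_exactTwoDivisibility_of_not_isOfFinAddOrder W hK Dt β ι d₁ hy
  have hrk : W.mordellWeilRank = 1 := by rw [(hGZK W (le_of_eq hr)).1, hr]
  have hT : NoRationalTwoTorsion W := noRationalTwoTorsion_of_natCard_selmerGroup_eq_two W hSel (le_of_eq hrk.symm)
  -- the globally minimal silent twin: Sel₂-trivial (image-free egg dichotomy), non-CM, analytic rank 0, `BSD₂` by the wall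
  obtain ⟨Wd, iE, iM, Cd, hCd⟩ := exists_globallyMinimal_model_twist W hD0
  have hSil : padicValNat 2 Wd.tamagawaProduct = padicValNat 2 W.tamagawaProduct :=
    padicValNat_two_tamagawaProduct_twin_eq_of_discr_eq_neg_prime_of_noRoot W hK hodd hH hℓ hd hnoRoot Cd hCd
  have hSel1 : Nat.card (Wd.selmerGroup 2) = 1 :=
    natCard_selmerGroup_twin_eq_one_of_meetsEgg_of_silent_of_noRationalTwoTorsion W hK hodd hH hΔ hT hrk hSel Cd hCd hSil hegg
  have hcmd : ¬ Wd.HasCM := by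
    rw [← hCd, hasCM_iff_of_j_eq (((W.quadraticTwist (NumberField.discr K : ℚ)).variableChange_j Cd).trans (W.j_quadraticTwist hD0))]
    exact hcm
  have hrd : Wd.analyticRank = 0 := by
    rw [← hCd, analyticRank_smul]
    exact ((W.quadraticTwist (NumberField.discr K : ℚ)).analyticRank_eq_zero_iff_holds (hmod _)).mpr hL
  have hBd : BSDp Wd 2 := hS1 Wd hcmd hrd hSel1
  -- the depth-free pin
  have hM₀ : M₀ = padicValInt 2 Dt.c + padicValNat 2 W.tamagawaProduct :=
    twoDivExponent_eq_of_bsdp_silent W K (hGZ _ W K) hGZK hmod hMilneC hr hSel hK hodd h3 hH Dt hc0 β ι d₁ hy hdiv hndiv Wd ⟨Cd, hCd⟩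
      hSel1 hSil hBW hBd
  subst hM₀
  exact ⟨hdiv, hndiv⟩

/-! ## §8 On the egg, U₂ ⟺ EXP⁺_all (image-free) modulo wall + converse + PRINT -/

/-- **U₂ ON THE EGG ⟹ EXP⁺_all (image-free)** — the exponent hypothesis of `…EggAllImages` §4 is IMPLIED by U₂ restricted to the egg locus, modulo GZ,
GZK, modularity, Milne and the wall S1 (its `L ≠ 0` binder makes the twin analytic-rank-`0`; no converse needed in this direction).  CONDITIONAL on
the displayed hypotheses; proves nothing about BSD; closes nothing.  [cite: GrossZagier1986, V §2 (2.2)] [cite: Kramer1981, §2 Props. 3, 6] -/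
theorem expPos_allImages_of_bsdp_egg_of_facts
    (hGZ : ∀ (N : ℕ) [NeZero N] (W : WeierstrassCurve ℚ) (K : Type) [Field K] [NumberField K], gross_zagier N W K)
    (hGZK : rank_eq_analyticRank_of_analyticRank_le_one) (hmod : hasEntireLFunction_rat)
    (hMilneC : Milne1972.bsdQuotient_baseChange_quadratic_anyModel)
    (hS1 : ∀ (W : WeierstrassCurve ℚ) [W.IsElliptic] [W.IsGloballyMinimal],
      ¬ W.HasCM → W.analyticRank = 0 → Nat.card (W.selmerGroup 2) = 1 → BSDp W 2)
    (hU : ∀ (W : WeierstrassCurve ℚ) [W.IsElliptic] [W.IsGloballyMinimal], ¬ W.HasCM → W.analyticRank = 1 →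
      Nat.card (W.selmerGroup 2) = 2 → 0 < W.Δ → MeetsEgg W → BSDp W 2) :
    ∀ (W : WeierstrassCurve ℚ) [W.IsElliptic] [W.IsGloballyMinimal] [NeZero (W.conductorNorm ℤ)],
      ¬ W.HasCM → W.analyticRank = 1 → Nat.card (W.selmerGroup 2) = 2 → 0 < W.Δ → MeetsEgg W →
      ∀ (K : Type) [Field K] [NumberField K], IsImaginaryQuadratic K →
        ∀ (ℓ : ℕ), ℓ.Prime → NumberField.discr K = -(ℓ : ℤ) →
        (∀ x : ZMod ℓ, 4 * x ^ 3 + ((integralModelInt W).b₂ : ZMod ℓ) * x ^ 2 +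
            2 * ((integralModelInt W).b₄ : ZMod ℓ) * x + ((integralModelInt W).b₆ : ZMod ℓ) ≠ 0) →
        Odd (NumberField.discr K) → NumberField.discr K ≠ -3 → SatisfiesHeegnerHypothesis (W.conductorNorm ℤ) K →
        (W.quadraticTwist (NumberField.discr K : ℚ)).entireLFunction 1 ≠ 0 →
        ∀ (Dt : ModularParametrizationData W (W.conductorNorm ℤ)) (β : ℤ) (ι : K →+* ℂ) (d₁ : KolyvaginHeegnerData Dt β ι 1),
          (∃ Q : (W.baseChange (ringClassField K ι 1)).toAffine.Point,
            ((2 ^ (padicValInt 2 Dt.c + padicValNat 2 W.tamagawaProduct) : ℕ) : ℤ) • Q = d₁.derivedPoint) ∧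
          (¬ ∃ Q : (W.baseChange (ringClassField K ι 1)).toAffine.Point,
            ((2 ^ (padicValInt 2 Dt.c + padicValNat 2 W.tamagawaProduct + 1) : ℕ) : ℤ) • Q = d₁.derivedPoint) := by
  intro W _ _ _ hcm hr hSel hΔ hegg K _ _ hK ℓ hℓ hd hnoRoot hodd h3 hH hL Dt β ι d₁
  exact exponent_of_bsdp_of_silentPrime_allDepth_allImages hGZ hGZK hmod hMilneC hS1 W hcm hr hSel hΔ hegg (hU W hcm hr hSel hΔ hegg)
    hK hℓ hd hnoRoot hodd h3 hH hL Dt β ι d₁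

/-- **ON THE EGG, U₂ ⟺ EXP⁺_all (image-free, every Tamagawa depth)**, modulo GZ, GZK, modularity, Milne, the modular parametrisation, the wall S1 and
the rank-zero `2`-converse CONV₀ (the converse enters only in ⟸, `…EggAllImages` §4).  So the image-free exponent hypothesis of LINE 23's egg engine is
LOSSLESS: it is refutable only together with U₂ itself (given wall + converse + print).  CONDITIONAL on the displayed hypotheses; proves nothing about
BSD; closes nothing.  [cite: GrossZagier1986, V §2 (2.2)] [cite: Kramer1981, §2 Props. 3, 6] [cite: MazurRubin2010, Cor. 3.4 (i)] -/
theorem bsdp_egg_iff_expPos_allImages_of_facts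
    (hGZ : ∀ (N : ℕ) [NeZero N] (W : WeierstrassCurve ℚ) (K : Type) [Field K] [NumberField K], gross_zagier N W K)
    (hGZK : rank_eq_analyticRank_of_analyticRank_le_one) (hmod : hasEntireLFunction_rat)
    (hMilneC : Milne1972.bsdQuotient_baseChange_quadratic_anyModel) (hMP : nonempty_modularParametrizationData)
    (hS1 : ∀ (W : WeierstrassCurve ℚ) [W.IsElliptic] [W.IsGloballyMinimal],
      ¬ W.HasCM → W.analyticRank = 0 → Nat.card (W.selmerGroup 2) = 1 → BSDp W 2)
    (hC0 : ∀ (V : WeierstrassCurve ℚ) [V.IsElliptic] [V.IsGloballyMinimal], ¬ V.HasCM → V.selmerCorank 2 = 0 → V.analyticRank = 0) :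
    (∀ (W : WeierstrassCurve ℚ) [W.IsElliptic] [W.IsGloballyMinimal], ¬ W.HasCM → W.analyticRank = 1 →
      Nat.card (W.selmerGroup 2) = 2 → 0 < W.Δ → MeetsEgg W → BSDp W 2) ↔
    (∀ (W : WeierstrassCurve ℚ) [W.IsElliptic] [W.IsGloballyMinimal] [NeZero (W.conductorNorm ℤ)],
      ¬ W.HasCM → W.analyticRank = 1 → Nat.card (W.selmerGroup 2) = 2 → 0 < W.Δ → MeetsEgg W →
      ∀ (K : Type) [Field K] [NumberField K], IsImaginaryQuadratic K →
        ∀ (ℓ : ℕ), ℓ.Prime → NumberField.discr K = -(ℓ : ℤ) →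
        (∀ x : ZMod ℓ, 4 * x ^ 3 + ((integralModelInt W).b₂ : ZMod ℓ) * x ^ 2 +
            2 * ((integralModelInt W).b₄ : ZMod ℓ) * x + ((integralModelInt W).b₆ : ZMod ℓ) ≠ 0) →
        Odd (NumberField.discr K) → NumberField.discr K ≠ -3 → SatisfiesHeegnerHypothesis (W.conductorNorm ℤ) K →
        (W.quadraticTwist (NumberField.discr K : ℚ)).entireLFunction 1 ≠ 0 →
        ∀ (Dt : ModularParametrizationData W (W.conductorNorm ℤ)) (β : ℤ) (ι : K →+* ℂ) (d₁ : KolyvaginHeegnerData Dt β ι 1),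
          (∃ Q : (W.baseChange (ringClassField K ι 1)).toAffine.Point,
            ((2 ^ (padicValInt 2 Dt.c + padicValNat 2 W.tamagawaProduct) : ℕ) : ℤ) • Q = d₁.derivedPoint) ∧
          (¬ ∃ Q : (W.baseChange (ringClassField K ι 1)).toAffine.Point,
            ((2 ^ (padicValInt 2 Dt.c + padicValNat 2 W.tamagawaProduct + 1) : ℕ) : ℤ) • Q = d₁.derivedPoint)) :=
  ⟨fun hU ↦ expPos_allImages_of_bsdp_egg_of_facts hGZ hGZK hmod hMilneC hS1 hU,
    fun hEXPpos ↦ bsdp_posDisc_egg_of_wall_of_converse_of_exponent_of_facts_allImages hGZ hGZK hmod hMilneC hMP hS1 hC0 hEXPpos⟩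

end Summit.BirchSwinnertonDyer.BirchSwinnertonDyer.Theorems.GenusExact.TwinSwap.EggAllImages

end
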